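import Mathlib
import HarnessLib

/-!
# The three-band (Emery) d–p Bloch matrix: closed-form antibonding band at Γ, X, M, S, and the
# one-band `t–t′–t″` form identified by four band energies

Venture CertifiedManyBodySolver, cell `pub/hubbard-downfold` (HUMAN RULINGS D-0096/D-0098: stage S1 =
DOWNFOLDING FRONT END; the three-band → one-band reduction error is carried as explicit box
inflation, never hidden), seat hubbard-downfold-mod-4; namespace
`Summit.Ventures.CertifiedManyBodySolver.Downfold.Emery`. Everything here is PROVED (exact algebra of
a 3 × 3 matrix and of four cosines). WHAT THIS IS NOT: a statement about any material; no
literature number lives here; not the interaction (`U`) reduction; not the generic Löwdin /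
Schur-complement identity (`Literature.MathematicalPhysics.QuantumLattice.DownfoldingIdentities`,
energy-dependent) — this file is the energy-INDEPENDENT one-band form obtained by matching four
band energies (the "technique B" of the cell's `router/INFLATION-RULES.md §3to1-B`).

* §1 `oneBand c t t' t''` — the square-lattice one-band dispersion in the hubbard-fast DICTIONARY D0
  convention `ε₁(k) = c − 2t(cos kx + cos ky) − 4t′ cos kx cos ky − 2t″(cos 2kx + cos 2ky)` (so
  `H = −t Σ_nn − t′ Σ_nnn − t″ Σ_3rd`, cuprate-like ⇔ `t′ < 0`); its values at Γ = (0,0), X = (π,0),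
  M = (π,π), S = (π/2,π/2); the FOUR-POINT EXTRACTION `extract (eΓ, eX, eM, eS) = (c, t, t′, t″)`,
  a two-sided inverse (`extract_oneBand`, `extract_matches_*`); and its ℓ¹ operator norms
  (`abs_extractT_sub_le`, `abs_extractTp_sub_le`, `abs_extractTpp_sub_le`): a band misfit `ρ` at
  the four k-points moves each of `t, t′, t″` by at most `ρ/4` — the per-coordinate reduction
  error is DERIVED from the band misfit, not asserted (reviewer unc-3, R5).
* §2 `bloch Δ tpd tpp sx sy` — the d–pₓ–p_y Bloch matrix (electron picture, real gauge, `ε_d = 0`,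
  `ε_p = −Δ`, `sx = sin(kx/2)`, `sy = sin(ky/2)`); the closed-form ANTIBONDING energies
  `abX = (−Δ + √(Δ² + 16t_pd²))/2`, `abM = (−Δ + 4t_pp + √((Δ − 4t_pp)² + 32t_pd²))/2`,
  `abS = (−Δ + 2t_pp + √((Δ − 2t_pp)² + 16t_pd²))/2` (at Γ the d level decouples: `ε_AB(Γ) = 0`);
  proofs that they are eigenvalues (`det_bloch_*_ab*`: the characteristic cubic factorises at these
  k-points) and that they are the TOP eigenvalue in the physical regime `Δ ≥ 0`, `t_pp ≥ 0`
  (`le_abX_of_det_eq_zero`, `le_abM_of_det_eq_zero`, `le_abS_of_det_eq_zero`).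

The reduction map `(Δ, t_pd, t_pp) ↦ (t, t′, t″)` built from these, its monotonicity and box
enclosures: `Downfold.EmeryBandReduction`; the typed box-level statement: `Downfold.ThreeToOneBand`.
Sources: the three-band model of Emery (1987) in the parametrisation of Hybertsen–Schlüter–
Christensen, *Phys. Rev. B* 39 (1989) 9028 [HybertsenSchluterChristensen1989]; four-orbital →
one-orbital `t, t′, t″` language of Pavarini–Dasgupta–Saha-Dasgupta–Jepsen–Andersen, *Phys. Rev.
Lett.* 87 (2001) 047003 [PavariniEtAl2001]. The closed forms are elementary (roots of quadratics).
-/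

noncomputable section

namespace Summit.Ventures.CertifiedManyBodySolver.Downfold.Emery

open Real

/-! ## §1 One-band dispersion (D0 convention), four-point extraction, misfit propagation -/

/-- One-band square-lattice dispersion in the hubbard-fast DICTIONARY D0 convention
`ε₁(k) = c − 2t(cos kx + cos ky) − 4t′ cos kx cos ky − 2t″(cos 2kx + cos 2ky)`; cuprate-like means
`t′ < 0`. [cite: PavariniEtAl2001, Eq. (1) and Fig. 2 (t, t′, t″ one-band form)] -/
def oneBand (c t t' t'' kx ky : ℝ) : ℝ :=
  c - 2 * t * (Real.cos kx + Real.cos ky) - 4 * t' * (Real.cos kx * Real.cos ky)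
    - 2 * t'' * (Real.cos (2 * kx) + Real.cos (2 * ky))

/-- Value at Γ = (0,0): `c − 4t − 4t′ − 4t″`. [folklore] -/
theorem oneBand_Gamma (c t t' t'' : ℝ) : oneBand c t t' t'' 0 0 = c - 4 * t - 4 * t' - 4 * t'' := by
  simp [oneBand]
  ring

/-- Value at X = (π,0): `c + 4t′ − 4t″`. [folklore] -/
theorem oneBand_X (c t t' t'' : ℝ) : oneBand c t t' t'' π 0 = c + 4 * t' - 4 * t'' := by
  have h2 : Real.cos (2 * π) = 1 := by simp
  simp [oneBand, h2]
  ring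

/-- Value at M = (π,π): `c + 4t − 4t′ − 4t″`. [folklore] -/
theorem oneBand_M (c t t' t'' : ℝ) : oneBand c t t' t'' π π = c + 4 * t - 4 * t' - 4 * t'' := by
  have h2 : Real.cos (2 * π) = 1 := by simp
  simp [oneBand, h2]
  ring

/-- Value at S = (π/2,π/2): `c + 4t″`. [folklore] -/
theorem oneBand_S (c t t' t'' : ℝ) : oneBand c t t' t'' (π / 2) (π / 2) = c + 4 * t'' := by
  have h2 : Real.cos (2 * (π / 2)) = -1 := by
    rw [show 2 * (π / 2) = π by ring]; simp
  simp [oneBand, h2]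
  ring

/-- FOUR-POINT EXTRACTION, `t` component: `t = (eM − eΓ)/8`. [folklore] -/
def extractT (eΓ eM : ℝ) : ℝ := (eM - eΓ) / 8

/-- FOUR-POINT EXTRACTION, `t′` component (D0 sign): `t′ = (2eX − eΓ − eM)/16`. [folklore] -/
def extractTp (eΓ eX eM : ℝ) : ℝ := (2 * eX - eΓ - eM) / 16

/-- FOUR-POINT EXTRACTION, `t″` component: `t″ = (eS − eX)/8 + t′/2 = eS/8 − eX/16 − (eΓ + eM)/32`.
[folklore] -/
def extractTpp (eΓ eX eM eS : ℝ) : ℝ := (eS - eX) / 8 + extractTp eΓ eX eM / 2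

/-- FOUR-POINT EXTRACTION, constant: `c = eS − 4t″`. [folklore] -/
def extractC (eΓ eX eM eS : ℝ) : ℝ := eS - 4 * extractTpp eΓ eX eM eS

/-- The four-point extraction as one map `(eΓ, eX, eM, eS) ↦ (c, t, t′, t″)`. [folklore] -/
def extract (eΓ eX eM eS : ℝ) : ℝ × ℝ × ℝ × ℝ :=
  (extractC eΓ eX eM eS, extractT eΓ eM, extractTp eΓ eX eM, extractTpp eΓ eX eM eS)

/-- Extraction is a left inverse of evaluation: from the four values of `oneBand c t t′ t″` at
Γ, X, M, S it returns `(c, t, t′, t″)` — the one-band form is identified by those four values.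
[folklore] -/
theorem extract_oneBand (c t t' t'' : ℝ) :
    extract (oneBand c t t' t'' 0 0) (oneBand c t t' t'' π 0) (oneBand c t t' t'' π π)
      (oneBand c t t' t'' (π / 2) (π / 2)) = (c, t, t', t'') := by
  rw [oneBand_Gamma, oneBand_X, oneBand_M, oneBand_S]
  simp only [extract, extractC, extractT, extractTp, extractTpp, Prod.mk.injEq]
  refine ⟨by ring, by ring, by ring, by ring⟩

/-- The extracted one-band form reproduces the prescribed Γ value. [folklore] -/
theorem extract_matches_Gamma (eΓ eX eM eS : ℝ) :
    oneBand (extractC eΓ eX eM eS) (extractT eΓ eM) (extractTp eΓ eX eM) (extractTpp eΓ eX eM eS)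
      0 0 = eΓ := by
  rw [oneBand_Gamma]; simp only [extractC, extractT, extractTp, extractTpp]; ring

/-- The extracted one-band form reproduces the prescribed X value. [folklore] -/
theorem extract_matches_X (eΓ eX eM eS : ℝ) :
    oneBand (extractC eΓ eX eM eS) (extractT eΓ eM) (extractTp eΓ eX eM) (extractTpp eΓ eX eM eS)
      π 0 = eX := by
  rw [oneBand_X]; simp only [extractC, extractTp, extractTpp]; ring

/-- The extracted one-band form reproduces the prescribed M value. [folklore] -/
theorem extract_matches_M (eΓ eX eM eS : ℝ) :
    oneBand (extractC eΓ eX eM eS) (extractT eΓ eM) (extractTp eΓ eX eM) (extractTpp eΓ eX eM eS)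
      π π = eM := by
  rw [oneBand_M]; simp only [extractC, extractT, extractTp, extractTpp]; ring

/-- The extracted one-band form reproduces the prescribed S value. [folklore] -/
theorem extract_matches_S (eΓ eX eM eS : ℝ) :
    oneBand (extractC eΓ eX eM eS) (extractT eΓ eM) (extractTp eΓ eX eM) (extractTpp eΓ eX eM eS)
      (π / 2) (π / 2) = eS := by
  rw [oneBand_S]; simp only [extractC, extractTp, extractTpp]; ring

/-- **Misfit propagation, `t`** (ℓ¹ norm of the extraction row `(−1, 0, 1, 0)/8`): if two sets of
band energies differ by at most `ρ` at Γ and M, the extracted `t` values differ by at most `ρ/4`.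
[folklore] -/
theorem abs_extractT_sub_le {eΓ eM eΓ' eM' ρ : ℝ} (hΓ : |eΓ - eΓ'| ≤ ρ) (hM : |eM - eM'| ≤ ρ) :
    |extractT eΓ eM - extractT eΓ' eM'| ≤ ρ / 4 := by
  have h : extractT eΓ eM - extractT eΓ' eM' = ((eM - eM') - (eΓ - eΓ')) / 8 := by
    simp only [extractT]; ring
  rw [h, abs_div, abs_of_pos (by norm_num : (0:ℝ) < 8)]
  have := abs_sub (eM - eM') (eΓ - eΓ')
  linarith

/-- **Misfit propagation, `t′`** (row `(−1, 2, −1, 0)/16`): band misfit `≤ ρ` at Γ, X, M moves `t′`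
by at most `ρ/4`. [folklore] -/
theorem abs_extractTp_sub_le {eΓ eX eM eΓ' eX' eM' ρ : ℝ} (hΓ : |eΓ - eΓ'| ≤ ρ)
    (hX : |eX - eX'| ≤ ρ) (hM : |eM - eM'| ≤ ρ) :
    |extractTp eΓ eX eM - extractTp eΓ' eX' eM'| ≤ ρ / 4 := by
  have h : extractTp eΓ eX eM - extractTp eΓ' eX' eM' =
      (2 * (eX - eX') - (eΓ - eΓ') - (eM - eM')) / 16 := by
    simp only [extractTp]; ring
  rw [h, abs_div, abs_of_pos (by norm_num : (0:ℝ) < 16)]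
  have h1 := abs_sub (2 * (eX - eX') - (eΓ - eΓ')) (eM - eM')
  have h2 := abs_sub (2 * (eX - eX')) (eΓ - eΓ')
  have h3 : |2 * (eX - eX')| = 2 * |eX - eX'| := by
    rw [abs_mul, abs_of_pos (by norm_num : (0:ℝ) < 2)]
  linarith

/-- **Misfit propagation, `t″`** (row `(−1, −2, −1, 4)/32`): band misfit `≤ ρ` at Γ, X, M, S moves
`t″` by at most `ρ/4`. [folklore] -/
theorem abs_extractTpp_sub_le {eΓ eX eM eS eΓ' eX' eM' eS' ρ : ℝ} (hΓ : |eΓ - eΓ'| ≤ ρ)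
    (hX : |eX - eX'| ≤ ρ) (hM : |eM - eM'| ≤ ρ) (hS : |eS - eS'| ≤ ρ) :
    |extractTpp eΓ eX eM eS - extractTpp eΓ' eX' eM' eS'| ≤ ρ / 4 := by
  have h : extractTpp eΓ eX eM eS - extractTpp eΓ' eX' eM' eS' =
      (4 * (eS - eS') - 2 * (eX - eX') - (eΓ - eΓ') - (eM - eM')) / 32 := by
    simp only [extractTpp, extractTp]; ring
  rw [h, abs_div, abs_of_pos (by norm_num : (0:ℝ) < 32)]
  have h1 := abs_sub (4 * (eS - eS') - 2 * (eX - eX') - (eΓ - eΓ')) (eM - eM')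
  have h2 := abs_sub (4 * (eS - eS') - 2 * (eX - eX')) (eΓ - eΓ')
  have h3 := abs_sub (4 * (eS - eS')) (2 * (eX - eX'))
  have h4 : |4 * (eS - eS')| = 4 * |eS - eS'| := by
    rw [abs_mul, abs_of_pos (by norm_num : (0:ℝ) < 4)]
  have h5 : |2 * (eX - eX')| = 2 * |eX - eX'| := by
    rw [abs_mul, abs_of_pos (by norm_num : (0:ℝ) < 2)]
  linarith

/-! ## §2 The three-band Bloch matrix and its antibonding band at X, M, S -/

/-- Three-band d–pₓ–p_y Bloch matrix, electron picture, real gauge, basis `(d, pₓ, p_y)`, on-site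
energies `ε_d = 0`, `ε_p = −Δ` (`Δ` = charge-transfer energy = `ε_p − ε_d` in HOLE language), with
`sx = sin(kx/2)`, `sy = sin(ky/2)`: d–pₓ `2 t_pd sx`, d–p_y `−2 t_pd sy`, pₓ–p_y `−4 t_pp sx sy`
(`t_pp > 0` raises the b₁g oxygen combination that hybridises with d at M ⇒ cuprate-like `t′ < 0`).
[cite: HybertsenSchluterChristensen1989, Eq. (1) (three-band d–p model)] -/
def bloch (Δ tpd tpp sx sy : ℝ) : Matrix (Fin 3) (Fin 3) ℝ :=
  !![0, 2 * tpd * sx, -2 * tpd * sy;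
     2 * tpd * sx, -Δ, -4 * tpp * sx * sy;
     -2 * tpd * sy, -4 * tpp * sx * sy, -Δ]

/-- Characteristic determinant `det (bloch − ε • 1)` as an explicit cubic (all k). [folklore] -/
theorem det_bloch_sub (Δ tpd tpp sx sy ε : ℝ) :
    (bloch Δ tpd tpp sx sy - ε • (1 : Matrix (Fin 3) (Fin 3) ℝ)).det =
      (-ε) * ((-Δ - ε) * (-Δ - ε) - (4 * tpp * sx * sy) ^ 2)
        - (2 * tpd * sx) * ((2 * tpd * sx) * (-Δ - ε) - (4 * tpp * sx * sy) * (2 * tpd * sy))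
        + (-2 * tpd * sy) * (-(2 * tpd * sx) * (4 * tpp * sx * sy) - (-Δ - ε) * (-2 * tpd * sy)) := by
  simp [bloch, Matrix.det_fin_three, Matrix.sub_apply, Matrix.smul_apply]
  ring

/-- Antibonding energy at X = (π,0) (`sx = 1`, `sy = 0`): `ε_AB(X) = (−Δ + √(Δ² + 16 t_pd²))/2`,
the upper root of `ε(ε + Δ) = 4 t_pd²`. [folklore] -/
def abX (Δ tpd : ℝ) : ℝ := (-Δ + Real.sqrt (Δ ^ 2 + 16 * tpd ^ 2)) / 2

/-- Antibonding energy at M = (π,π) (`sx = sy = 1`):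
`ε_AB(M) = (−Δ + 4t_pp + √((Δ − 4t_pp)² + 32 t_pd²))/2`, the upper root of
`ε(ε + Δ − 4t_pp) = 8 t_pd²` (d couples only to the b₁g combination `(pₓ − p_y)/√2`, whose level is
`−Δ + 4 t_pp`). [folklore] -/
def abM (Δ tpd tpp : ℝ) : ℝ := (-Δ + 4 * tpp + Real.sqrt ((Δ - 4 * tpp) ^ 2 + 32 * tpd ^ 2)) / 2

/-- Antibonding energy at S = (π/2,π/2) (`sx = sy = √2/2`):
`ε_AB(S) = (−Δ + 2t_pp + √((Δ − 2t_pp)² + 16 t_pd²))/2`, the upper root of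
`ε(ε + Δ − 2t_pp) = 4 t_pd²`. [folklore] -/
def abS (Δ tpd tpp : ℝ) : ℝ := (-Δ + 2 * tpp + Real.sqrt ((Δ - 2 * tpp) ^ 2 + 16 * tpd ^ 2)) / 2

/-- `√(Δ² + 16 t_pd²)² = Δ² + 16 t_pd²`. [folklore] -/
theorem sq_sqrt_X (Δ tpd : ℝ) :
    Real.sqrt (Δ ^ 2 + 16 * tpd ^ 2) ^ 2 = Δ ^ 2 + 16 * tpd ^ 2 :=
  Real.sq_sqrt (by positivity)

/-- `√((Δ − 4t_pp)² + 32 t_pd²)² = (Δ − 4t_pp)² + 32 t_pd²`. [folklore] -/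
theorem sq_sqrt_M (Δ tpd tpp : ℝ) :
    Real.sqrt ((Δ - 4 * tpp) ^ 2 + 32 * tpd ^ 2) ^ 2 = (Δ - 4 * tpp) ^ 2 + 32 * tpd ^ 2 :=
  Real.sq_sqrt (by positivity)

/-- `√((Δ − 2t_pp)² + 16 t_pd²)² = (Δ − 2t_pp)² + 16 t_pd²`. [folklore] -/
theorem sq_sqrt_S (Δ tpd tpp : ℝ) :
    Real.sqrt ((Δ - 2 * tpp) ^ 2 + 16 * tpd ^ 2) ^ 2 = (Δ - 2 * tpp) ^ 2 + 16 * tpd ^ 2 :=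
  Real.sq_sqrt (by positivity)

/-- `abX` solves its secular equation `ε(ε + Δ) = 4 t_pd²`. [folklore] -/
theorem abX_secular (Δ tpd : ℝ) : abX Δ tpd * (abX Δ tpd + Δ) = 4 * tpd ^ 2 := by
  have h := sq_sqrt_X Δ tpd
  unfold abX
  nlinarith [h]

/-- `abM` solves its secular equation `ε(ε + Δ − 4t_pp) = 8 t_pd²`. [folklore] -/
theorem abM_secular (Δ tpd tpp : ℝ) :
    abM Δ tpd tpp * (abM Δ tpd tpp + Δ - 4 * tpp) = 8 * tpd ^ 2 := by
  have h := sq_sqrt_M Δ tpd tpp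
  unfold abM
  nlinarith [h]

/-- `abS` solves its secular equation `ε(ε + Δ − 2t_pp) = 4 t_pd²`. [folklore] -/
theorem abS_secular (Δ tpd tpp : ℝ) :
    abS Δ tpd tpp * (abS Δ tpd tpp + Δ - 2 * tpp) = 4 * tpd ^ 2 := by
  have h := sq_sqrt_S Δ tpd tpp
  unfold abS
  nlinarith [h]

/-- At X the characteristic cubic factorises: `det = (−Δ − ε)·(ε(ε+Δ) − 4t_pd²)`. [folklore] -/
theorem det_bloch_X (Δ tpd tpp ε : ℝ) :
    (bloch Δ tpd tpp 1 0 - ε • (1 : Matrix (Fin 3) (Fin 3) ℝ)).det =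
      (-Δ - ε) * (ε * (ε + Δ) - 4 * tpd ^ 2) := by
  rw [det_bloch_sub]; ring

/-- At M the characteristic cubic factorises: `det = (−Δ − 4t_pp − ε)·(ε(ε+Δ−4t_pp) − 8t_pd²)`.
[folklore] -/
theorem det_bloch_M (Δ tpd tpp ε : ℝ) :
    (bloch Δ tpd tpp 1 1 - ε • (1 : Matrix (Fin 3) (Fin 3) ℝ)).det =
      (-Δ - 4 * tpp - ε) * (ε * (ε + Δ - 4 * tpp) - 8 * tpd ^ 2) := by
  rw [det_bloch_sub]; ring

/-- At S (`sx = sy = √2/2 = sin(π/4)`) the characteristic cubic factorises: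
`det = (−Δ − 2t_pp − ε)·(ε(ε+Δ−2t_pp) − 4t_pd²)`. [folklore] -/
theorem det_bloch_S (Δ tpd tpp ε : ℝ) :
    (bloch Δ tpd tpp (Real.sqrt 2 / 2) (Real.sqrt 2 / 2) - ε • (1 : Matrix (Fin 3) (Fin 3) ℝ)).det =
      (-Δ - 2 * tpp - ε) * (ε * (ε + Δ - 2 * tpp) - 4 * tpd ^ 2) := by
  rw [det_bloch_sub]
  have h2 : Real.sqrt 2 ^ 2 = 2 := Real.sq_sqrt (by norm_num)
  have h4 : Real.sqrt 2 ^ 4 = 4 := by nlinarith [h2]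
  ring_nf
  rw [h2, h4]
  ring

/-- `sin(π/4) = √2/2`: the S point of `bloch` is `sx = sy = sin((π/2)/2)`. [folklore] -/
theorem sin_half_S : Real.sin ((π / 2) / 2) = Real.sqrt 2 / 2 := by
  rw [show (π / 2) / 2 = π / 4 by ring, Real.sin_pi_div_four]

/-- `abX` is an eigenvalue of the Bloch matrix at X. [folklore] -/
theorem det_bloch_X_abX (Δ tpd tpp : ℝ) :
    (bloch Δ tpd tpp 1 0 - abX Δ tpd • (1 : Matrix (Fin 3) (Fin 3) ℝ)).det = 0 := by
  rw [det_bloch_X, abX_secular]; ring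

/-- `abM` is an eigenvalue of the Bloch matrix at M. [folklore] -/
theorem det_bloch_M_abM (Δ tpd tpp : ℝ) :
    (bloch Δ tpd tpp 1 1 - abM Δ tpd tpp • (1 : Matrix (Fin 3) (Fin 3) ℝ)).det = 0 := by
  rw [det_bloch_M, abM_secular]; ring

/-- `abS` is an eigenvalue of the Bloch matrix at S. [folklore] -/
theorem det_bloch_S_abS (Δ tpd tpp : ℝ) :
    (bloch Δ tpd tpp (Real.sqrt 2 / 2) (Real.sqrt 2 / 2)
        - abS Δ tpd tpp • (1 : Matrix (Fin 3) (Fin 3) ℝ)).det = 0 := by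
  rw [det_bloch_S, abS_secular]; ring

/-- `|x| ≤ √(x² + a)` for `a ≥ 0`. [folklore] -/
theorem abs_le_sqrt_sq_add {x a : ℝ} (ha : 0 ≤ a) : |x| ≤ Real.sqrt (x ^ 2 + a) := by
  rw [← Real.sqrt_sq_eq_abs]
  exact Real.sqrt_le_sqrt (by linarith)

/-- `abX ≥ 0 = ε_d` (the antibonding band lies above the d level at X). [folklore] -/
theorem abX_nonneg (Δ tpd : ℝ) : 0 ≤ abX Δ tpd := by
  unfold abX
  have h1 := abs_le_sqrt_sq_add (x := Δ) (a := 16 * tpd ^ 2) (by positivity)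
  have h2 : Δ ≤ |Δ| := le_abs_self Δ
  linarith

/-- `abM ≥ 0`. [folklore] -/
theorem abM_nonneg (Δ tpd tpp : ℝ) : 0 ≤ abM Δ tpd tpp := by
  unfold abM
  have h1 := abs_le_sqrt_sq_add (x := Δ - 4 * tpp) (a := 32 * tpd ^ 2) (by positivity)
  have h2 : Δ - 4 * tpp ≤ |Δ - 4 * tpp| := le_abs_self _
  linarith

/-- `abS ≥ 0`. [folklore] -/
theorem abS_nonneg (Δ tpd tpp : ℝ) : 0 ≤ abS Δ tpd tpp := by
  unfold abS
  have h1 := abs_le_sqrt_sq_add (x := Δ - 2 * tpp) (a := 16 * tpd ^ 2) (by positivity)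
  have h2 : Δ - 2 * tpp ≤ |Δ - 2 * tpp| := le_abs_self _
  linarith

/-- `abM + Δ − 4t_pp ≥ 0` (the antibonding root lies above the b₁g oxygen level too). [folklore] -/
theorem abM_add_nonneg (Δ tpd tpp : ℝ) : 0 ≤ abM Δ tpd tpp + Δ - 4 * tpp := by
  unfold abM
  have h1 := abs_le_sqrt_sq_add (x := Δ - 4 * tpp) (a := 32 * tpd ^ 2) (by positivity)
  have h2 : -(Δ - 4 * tpp) ≤ |Δ - 4 * tpp| := neg_le_abs _
  linarith

/-- `abS + Δ − 2t_pp ≥ 0`. [folklore] -/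
theorem abS_add_nonneg (Δ tpd tpp : ℝ) : 0 ≤ abS Δ tpd tpp + Δ - 2 * tpp := by
  unfold abS
  have h1 := abs_le_sqrt_sq_add (x := Δ - 2 * tpp) (a := 16 * tpd ^ 2) (by positivity)
  have h2 : -(Δ - 2 * tpp) ≤ |Δ - 2 * tpp| := neg_le_abs _
  linarith

/-- The larger root dominates: if `r ≥ 0`, `r + s ≥ 0`, `r (r + s) = c` and `ε (ε + s) = c`, then
`ε ≤ r` (the other root of the quadratic is `−r − s ≤ 0 ≤ r`). [folklore] -/
theorem le_of_quadratic_root {r s c ε : ℝ} (hr : 0 ≤ r) (hrs : 0 ≤ r + s) (hrc : r * (r + s) = c)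
    (hε : ε * (ε + s) = c) : ε ≤ r := by
  by_contra hlt
  push Not at hlt
  have key : (ε - r) * (ε + r + s) = 0 := by nlinarith
  rcases mul_eq_zero.mp key with k | k
  · linarith
  · nlinarith

/-- ANTIBONDING = TOP at X: in the regime `Δ ≥ 0` every eigenvalue at X is `≤ abX`
(the roots are `−Δ`, the bonding root and `abX`). [folklore] -/
theorem le_abX_of_det_eq_zero {Δ tpd tpp ε : ℝ} (hΔ : 0 ≤ Δ)
    (h : (bloch Δ tpd tpp 1 0 - ε • (1 : Matrix (Fin 3) (Fin 3) ℝ)).det = 0) : ε ≤ abX Δ tpd := by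
  rw [det_bloch_X] at h
  have hX := abX_nonneg Δ tpd
  rcases mul_eq_zero.mp h with h1 | h1
  · have : ε = -Δ := by linarith
    linarith
  · exact le_of_quadratic_root hX (by linarith) (abX_secular Δ tpd) (by linarith)

/-- ANTIBONDING = TOP at M: in the regime `Δ ≥ 0`, `t_pp ≥ 0` every eigenvalue at M is `≤ abM`
(the roots are the decoupled oxygen level `−Δ − 4t_pp`, the bonding root and `abM`). [folklore] -/
theorem le_abM_of_det_eq_zero {Δ tpd tpp ε : ℝ} (hΔ : 0 ≤ Δ) (htpp : 0 ≤ tpp)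
    (h : (bloch Δ tpd tpp 1 1 - ε • (1 : Matrix (Fin 3) (Fin 3) ℝ)).det = 0) :
    ε ≤ abM Δ tpd tpp := by
  rw [det_bloch_M] at h
  have hM := abM_nonneg Δ tpd tpp
  rcases mul_eq_zero.mp h with h1 | h1
  · have : ε = -Δ - 4 * tpp := by linarith
    linarith
  · have hs := abM_secular Δ tpd tpp
    have ha := abM_add_nonneg Δ tpd tpp
    exact le_of_quadratic_root (s := Δ - 4 * tpp) (c := 8 * tpd ^ 2) hM (by linarith)
      (by linarith) (by linarith)

/-- ANTIBONDING = TOP at S: in the regime `Δ ≥ 0`, `t_pp ≥ 0` every eigenvalue at S is `≤ abS`.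
[folklore] -/
theorem le_abS_of_det_eq_zero {Δ tpd tpp ε : ℝ} (hΔ : 0 ≤ Δ) (htpp : 0 ≤ tpp)
    (h : (bloch Δ tpd tpp (Real.sqrt 2 / 2) (Real.sqrt 2 / 2)
      - ε • (1 : Matrix (Fin 3) (Fin 3) ℝ)).det = 0) : ε ≤ abS Δ tpd tpp := by
  rw [det_bloch_S] at h
  have hS := abS_nonneg Δ tpd tpp
  rcases mul_eq_zero.mp h with h1 | h1
  · have : ε = -Δ - 2 * tpp := by linarith
    linarith
  · have hs := abS_secular Δ tpd tpp
    have ha := abS_add_nonneg Δ tpd tpp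
    exact le_of_quadratic_root (s := Δ - 2 * tpp) (c := 4 * tpd ^ 2) hS (by linarith)
      (by linarith) (by linarith)

end Summit.Ventures.CertifiedManyBodySolver.Downfold.Emery

end
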